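import Literature.Analysis.Distribution.RaySmearedBounds
import Literature.Analysis.Complex.TubeDiscPropagation
import Literature.Analysis.Complex.HolomorphicParametricIntegral
import Mathlib.MeasureTheory.Group.Integral
import Mathlib.Topology.MetricSpace.Thickening
import HarnessLib

/-!
# Ray-wise bounded pairings of a holomorphic function on a tube over a convex cone are bounded
in `𝒟'ᵐ` uniformly over every compact set of directions

Topic `Literature/Analysis/Distribution`; sequel of `RaySmearedBounds` (Banach–Steinhaus on each
ray, Baire over the directions) and consumer of the analytic-disc propagation lemma
`Literature.Analysis.Complex.norm_le_of_nearCone_of_disc` (`TubeDiscPropagation`). Setting as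
there: `f` holomorphic on an open `U ⊆ E` containing the tube `{J x + i J y : y ∈ Γ}` over an open
convex cone `Γ`, `μ` an additive Haar measure on the finite-dimensional real space `V`.

* `exists_uniform_smeared_bound` — if for every direction `η ∈ Γ` and every test function `F`
  supported in the ball `B̄(0, R₀ + 1)` the pairings `t ↦ ∫ f(J x + i t J η) F(x) dμ` are bounded
  on `t ∈ (0, 1]`, then for every compact `K ⊆ Γ` there are `s₀ > 0`, `m`, `M` with

    `|∫ f(J x + i s J k) F(x) dμ| ≤ M ‖F‖_{C^m}`  for all `k ∈ K`, `0 < s ≤ s₀`, `F ∈ 𝓓_{B̄(0,R₀)}`.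

Proof. `RaySmearedBounds` gives a ball of directions `B(ô, ρ₀) ⊆ Γ` and `m` with the bound
`m ‖F'‖_{C^m}` for all `F'` supported in `B̄(0, R₀ + 1)` and all heights `y ∈ (0,1] · B(ô, ρ₀)`.
For `F` supported in `B̄(0, R₀)` the **smeared function** `g_F(w) = ∫ f(J x + w) F(x) dμ` is
holomorphic on the open set `{w : J x + w ∈ U for ‖x‖ ≤ R₀}` (differentiation under the integral
sign, `HolomorphicParametricIntegral`), satisfies `g_F(J a + i J y) = ⟨f(· + iJy), F(· - a)⟩` by the
translation invariance of `μ`, hence `|g_F| ≤ m ‖F‖_{C^m}` on `{J a + i J y : ‖a‖ ≤ 1, y ∈ nearCone ô ρ₀}`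
(the translate `F(· - a)` is supported in `B̄(0, R₀ + 1)` with the same seminorms), and is bounded by
`C ‖F‖_{C^0}` on the compact pieces of the tube; the propagation lemma transports the bound to the
heights `s k`, `k ∈ K`, `s ≤ s₀`, at the base point `a = 0`, where `g_F(i s J k)` is the pairing in
question. [folklore] (The one-variable statement is Hörmander, *ALPDO I*, Thm. 3.1.14; see
`RaySmearedBounds` for the discussion of sources.)

## Mathlib / tree

Used: `Literature.Analysis.Complex.norm_le_of_nearCone_of_disc`,
`Literature.Analysis.Complex.differentiableOn_integral_of_dominated`,
`Literature.Analysis.Distribution.exists_seminorm_bound_of_ray_bounded`,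
`Literature.Analysis.Distribution.exists_ball_seminorm_bound`, `MeasureTheory.integral_add_right_eq_self`,
`IsCompact.eventually_forall_of_forall_eventually`, `IsCompact.exists_thickening_subset_open`,
`iteratedFDeriv_comp_sub`, `ContDiffMapSupportedIn.seminorm_top_le_iff`,
`ContDiffMapSupportedIn.norm_iteratedFDeriv_apply_le_seminorm_top`, `Seminorm.finset_sup_apply_le`.
-/

noncomputable section

open MeasureTheory Metric Set Filter ContDiffMapSupportedIn TopologicalSpace
open _root_.Complex _root_.Topology
open scoped Distributions NNReal

namespace Literature.Analysis.Distribution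

variable {V : Type*} [NormedAddCommGroup V] [NormedSpace ℝ V] [MeasurableSpace V] [BorelSpace V]
  [FiniteDimensional ℝ V]
variable {E : Type*} [NormedAddCommGroup E] [NormedSpace ℂ E]

/-! ### Translating test functions -/

/-- The closed ball `B̄(0, R)` as a compact set of `V`. [folklore] -/
def ballCompacts (R : ℝ) : Compacts V := ⟨closedBall 0 R, isCompact_closedBall 0 R⟩

omit [MeasurableSpace V] [BorelSpace V] in
/-- `(ballCompacts R : Set V) = closedBall 0 R`. [folklore] -/
@[simp] theorem coe_ballCompacts (R : ℝ) : ((ballCompacts R : Compacts V) : Set V) = closedBall 0 R :=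
  rfl

/-- **Translate of a test function**: for `F` supported in `B̄(0, R₀)` and `‖a‖ ≤ 1`, the function
`x ↦ F(x - a)` as an element of `𝓓_{B̄(0, R₀ + 1)}`. [folklore] -/
def translateTest {R₀ : ℝ} (F : 𝓓_{ballCompacts R₀}(V, ℂ)) (a : V) (ha : ‖a‖ ≤ 1) :
    𝓓_{ballCompacts (R₀ + 1)}(V, ℂ) where
  toFun x := F (x - a)
  contDiff' := F.contDiff.comp (contDiff_id.sub contDiff_const)
  zero_on_compl' := by
    intro x hx
    apply F.zero_on_compl
    simp only [coe_ballCompacts, mem_compl_iff, mem_closedBall_zero_iff, not_le] at hx ⊢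
    have := norm_sub_norm_le x a
    linarith

omit [MeasurableSpace V] [BorelSpace V] in
/-- Values of the translate. [folklore] -/
@[simp] theorem translateTest_apply {R₀ : ℝ} (F : 𝓓_{ballCompacts R₀}(V, ℂ)) (a : V) (ha : ‖a‖ ≤ 1)
    (x : V) : translateTest F a ha x = F (x - a) := rfl

omit [MeasurableSpace V] [BorelSpace V] in
/-- **Translation does not increase the `C^m` seminorms** (they are sup norms of derivatives,
`Dⁱ(F(· - a)) = (DⁱF)(· - a)`). [folklore] -/
theorem supSeminorm_translateTest_le {R₀ : ℝ} (F : 𝓓_{ballCompacts R₀}(V, ℂ)) (a : V)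
    (ha : ‖a‖ ≤ 1) (m : ℕ) :
    ContDiffMapSupportedIn.supSeminorm ℂ V ℂ ⊤ (ballCompacts (R₀ + 1)) m (translateTest F a ha) ≤
      ContDiffMapSupportedIn.supSeminorm ℂ V ℂ ⊤ (ballCompacts R₀) m F := by
  refine Seminorm.finset_sup_apply_le (apply_nonneg _ _) fun i hi => ?_
  have hle : N[ℂ]_{ballCompacts (R₀ + 1), i} (translateTest F a ha) ≤ N[ℂ]_{ballCompacts R₀, i} F := by
    refine (ContDiffMapSupportedIn.seminorm_top_le_iff ℂ (apply_nonneg _ _) i _).2 fun x _ => ?_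
    have h : iteratedFDeriv ℝ i (translateTest F a ha) x = iteratedFDeriv ℝ i F (x - a) := by
      have : (translateTest F a ha : V → ℂ) = fun z => F (z - a) := rfl
      rw [this, iteratedFDeriv_comp_sub]
    rw [h]
    exact norm_iteratedFDeriv_apply_le_seminorm_top ℂ
  refine hle.trans ?_
  exact Seminorm.le_def.1 (Finset.le_sup (f := ContDiffMapSupportedIn.seminorm ℂ V ℂ ⊤
    (ballCompacts R₀)) hi) F

/-! ### The smeared function `g_F(w) = ∫ f(J x + w) F(x) dμ` -/

/-- A product `h · φ` with `φ` continuous, `tsupport φ ⊆ O` open, `h` continuous on `O`, is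
continuous. [folklore] -/
theorem continuous_mul_of_tsupport_subset_complex {X : Type*} [TopologicalSpace X] {φ h : X → ℂ}
    {O : Set X} (hO : IsOpen O) (hφ : Continuous φ) (hsupp : tsupport φ ⊆ O)
    (hh : ContinuousOn h O) : Continuous fun x => h x * φ x := by
  rw [continuous_iff_continuousAt]
  intro x
  by_cases hx : x ∈ O
  · exact (hh.continuousAt (hO.mem_nhds hx)).mul hφ.continuousAt
  · have hx' : x ∉ tsupport φ := fun h' => hx (hsupp h')
    have h0 : (fun y => h y * φ y) =ᶠ[𝓝 x] fun _ => 0 := by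
      have : φ =ᶠ[𝓝 x] 0 := by rwa [← notMem_tsupport_iff_eventuallyEq]
      filter_upwards [this] with y hy
      simp [hy]
    exact (continuousAt_congr h0).2 continuousAt_const

variable {μ : Measure V} {J : V →L[ℝ] E} {f : E → ℂ} {U : Set E}

omit [MeasurableSpace V] [BorelSpace V] [FiniteDimensional ℝ V] in
/-- The set `{w : J x + w ∈ U for all x ∈ Kc}` of admissible smearing offsets is open
(`Kc` compact, `U` open). [folklore] -/
theorem isOpen_setOf_forall_mem_add (hU : IsOpen U) {Kc : Set V} (hKc : IsCompact Kc) :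
    IsOpen {w : E | ∀ x ∈ Kc, J x + w ∈ U} := by
  rw [isOpen_iff_mem_nhds]
  intro w₀ hw₀
  have h := hKc.eventually_forall_of_forall_eventually (x₀ := w₀)
    (P := fun w x => J x + w ∈ U) fun x hx => ?_
  · exact h
  · have hc : Continuous fun z : E × V => J z.2 + z.1 := by fun_prop
    exact hc.continuousAt.eventually (hU.mem_nhds (hw₀ x hx))

omit [FiniteDimensional ℝ V] in
/-- **The smeared function is holomorphic.** For `f` holomorphic on `U` and `F` a test function
supported in the compact `Kc`, `g_F(w) = ∫ f(J x + w) F(x) dμ` is complex differentiable on the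
open set `{w : J x + w ∈ U, x ∈ Kc}` (differentiation under the integral sign with the locally
uniform bound supplied by continuity of `f` and compactness of `Kc`). [folklore] -/
theorem differentiableOn_smeared [IsFiniteMeasureOnCompacts μ] (hU : IsOpen U)
    (hf : DifferentiableOn ℂ f U) {Kc : Compacts V} (F : 𝓓_{Kc}(V, ℂ)) :
    DifferentiableOn ℂ (fun w : E => ∫ x, f (J x + w) * F x ∂μ)
      {w : E | ∀ x ∈ (Kc : Set V), J x + w ∈ U} := by
  set U' : Set E := {w : E | ∀ x ∈ (Kc : Set V), J x + w ∈ U} with hU'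
  have hU'o : IsOpen U' := isOpen_setOf_forall_mem_add hU Kc.isCompact
  -- continuity of the integrands
  have hcont : ∀ w ∈ U', Continuous fun x => f (J x + w) * F x := by
    intro w hw
    have hOo : IsOpen {x : V | J x + w ∈ U} := hU.preimage (by fun_prop)
    refine continuous_mul_of_tsupport_subset_complex hOo F.continuous
      (F.tsupport_subset.trans fun x hx => hw x hx) ?_
    exact hf.continuousOn.comp (by fun_prop) fun x hx => hx
  refine Literature.Analysis.Complex.differentiableOn_integral_of_dominated
    (fun w hw => (hcont w hw).aestronglyMeasurable) ?_ ?_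
  · refine Eventually.of_forall fun x => ?_
    by_cases hx : x ∈ (Kc : Set V)
    · intro w hw
      have hd : DifferentiableAt ℂ (fun w : E => f (J x + w)) w :=
        (hf.differentiableAt (hU.mem_nhds (hw x hx))).comp w
          ((differentiableAt_const _).add differentiableAt_id)
      exact (hd.mul_const (F x)).differentiableWithinAt
    · have h0 : F x = 0 := F.zero_on_compl hx
      simp only [h0, mul_zero]
      exact differentiableOn_const 0
  · intro w₀ hw₀
    -- a uniform bound for `f (J x + w)`, `x ∈ Kc`, `w` near `w₀`
    obtain ⟨C₀, hC₀⟩ := Kc.isCompact.exists_bound_of_continuousOn (f := fun x => f (J x + w₀))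
      (hf.continuousOn.comp (by fun_prop : Continuous fun x : V => J x + w₀).continuousOn
        fun x hx => hw₀ x hx)
    have hev : ∀ᶠ w in 𝓝 w₀, ∀ x ∈ (Kc : Set V), ‖f (J x + w)‖ < ‖C₀‖ + 1 := by
      refine Kc.isCompact.eventually_forall_of_forall_eventually (x₀ := w₀)
        (P := fun w x => ‖f (J x + w)‖ < ‖C₀‖ + 1) fun x hx => ?_
      have hc : ContinuousAt (fun z : E × V => f (J z.2 + z.1)) (w₀, x) := by
        refine (hf.continuousOn.continuousAt (hU.mem_nhds ?_)).comp ?_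
        · exact hw₀ x hx
        · exact Continuous.continuousAt (by fun_prop)
      have hlt : ‖f (J x + w₀)‖ < ‖C₀‖ + 1 :=
        (hC₀ x hx).trans_lt ((le_abs_self C₀).trans_lt (lt_add_one _))
      exact (hc.norm.eventually (gt_mem_nhds hlt))
    obtain ⟨R, hR, hRsub⟩ := Metric.mem_nhds_iff.1 (inter_mem (hU'o.mem_nhds hw₀) hev)
    haveI : IsFiniteMeasure (μ.restrict (Kc : Set V)) :=
      isFiniteMeasure_restrict.2 Kc.isCompact.measure_lt_top.ne
    refine ⟨R, hR, fun w hw => (hRsub hw).1, fun x => (‖C₀‖ + 1) * ‖F x‖, ?_, ?_⟩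
    · exact (F.integrable.norm.const_mul _)
    · refine Eventually.of_forall fun x w hw => ?_
      by_cases hx : x ∈ (Kc : Set V)
      · rw [norm_mul]
        exact mul_le_mul_of_nonneg_right ((hRsub hw).2 x hx).le (norm_nonneg _)
      · simp [F.zero_on_compl hx]

omit [FiniteDimensional ℝ V] in
/-- **The smeared function at a tube point is a pairing with a translate**:
`g_F(J a + i J y) = ∫ f(J x + i J y) F(x - a) dμ(x)` (`μ` translation invariant). [folklore] -/
theorem smeared_tubePoint [μ.IsAddRightInvariant] (F : V → ℂ) (a y : V) :
    ∫ x, f (J x + (J a + (I : ℂ) • J y)) * F x ∂μ =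
      ∫ x, f (J x + (I : ℂ) • J y) * F (x - a) ∂μ := by
  have h := integral_add_right_eq_self (μ := μ) (fun x => f (J x + (I : ℂ) • J y) * F (x - a)) a
  simp only [add_sub_cancel_right, map_add] at h
  rw [← h]
  congr 1
  funext x
  rw [add_assoc]

/-! ### The uniform smeared bound over compact sets of directions -/

variable {Γ : Set V}

omit [MeasurableSpace V] [BorelSpace V] [FiniteDimensional ℝ V] in
/-- A compact subset of an open set can be shifted a little against a fixed vector:
`K - [0, ε₀] ô ⊆ Γ`. [folklore] -/
theorem exists_sub_smul_mem (hΓo : IsOpen Γ) {K : Set V} (hK : IsCompact K) (hKΓ : K ⊆ Γ) (ô : V) :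
    ∃ ε₀ : ℝ, 0 < ε₀ ∧ ∀ k ∈ K, ∀ ε ∈ Icc (0 : ℝ) ε₀, k - ε • ô ∈ Γ := by
  obtain ⟨δ, hδ, hδΓ⟩ := hK.exists_thickening_subset_open hΓo hKΓ
  refine ⟨δ / (‖ô‖ + 1), by positivity, fun k hk ε hε => hδΓ ?_⟩
  rw [mem_thickening_iff]
  refine ⟨k, hk, ?_⟩
  rw [dist_eq_norm, sub_sub_cancel_left, norm_neg, norm_smul, Real.norm_eq_abs,
    abs_of_nonneg hε.1]
  calc ε * ‖ô‖ ≤ δ / (‖ô‖ + 1) * ‖ô‖ := mul_le_mul_of_nonneg_right hε.2 (norm_nonneg _)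
    _ < δ := by
        rw [div_mul_eq_mul_div, div_lt_iff₀ (by positivity)]
        nlinarith [norm_nonneg ô]

/-- **Uniform `𝒟'ᵐ` bound over a compact set of directions.** Let `f` be holomorphic on an open
`U` containing the tube over the open convex cone `Γ`, `μ` an additive Haar measure, `R₀ ∈ ℝ`.
If for every `η ∈ Γ` and every `F` supported in `B̄(0, R₀ + 1)` the ray pairings
`t ↦ ∫ f(J x + i t J η) F(x) dμ`, `t ∈ (0, 1]`, are bounded, then for every compact `K ⊆ Γ` there
are `s₀ > 0`, `m ∈ ℕ`, `M` such that `|∫ f(J x + i s J k) F(x) dμ| ≤ M ‖F‖_{C^m}` for all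
`k ∈ K`, `0 < s ≤ s₀` and all `F` supported in `B̄(0, R₀)`. [folklore] -/
theorem exists_uniform_smeared_bound [μ.IsAddHaarMeasure] (hU : IsOpen U)
    (hf : DifferentiableOn ℂ f U) (hΓo : IsOpen Γ) (hΓc : Convex ℝ Γ)
    (hΓcone : ∀ c : ℝ, 0 < c → ∀ y ∈ Γ, c • y ∈ Γ)
    (htube : ∀ x : V, ∀ y ∈ Γ, J x + (I : ℂ) • J y ∈ U) {R₀ : ℝ}
    (hray : ∀ η ∈ Γ, ∀ F : 𝓓_{ballCompacts (R₀ + 1)}(V, ℂ), ∃ C : ℝ, ∀ t ∈ Ioc (0 : ℝ) 1,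
      ‖∫ x, f (J x + ((t : ℂ) * I) • J η) * F x ∂μ‖ ≤ C)
    {K : Set V} (hK : IsCompact K) (hKΓ : K ⊆ Γ) :
    ∃ (s₀ : ℝ) (m : ℕ) (M : ℝ), 0 < s₀ ∧ ∀ k ∈ K, ∀ s ∈ Ioc (0 : ℝ) s₀,
      ∀ F : 𝓓_{ballCompacts R₀}(V, ℂ),
        ‖∫ x, f (J x + (I : ℂ) • J (s • k)) * F x ∂μ‖ ≤
          M * ContDiffMapSupportedIn.supSeminorm ℂ V ℂ ⊤ (ballCompacts R₀) m F := by
  rcases K.eq_empty_or_nonempty with rfl | ⟨k₀, hk₀⟩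
  · exact ⟨1, 0, 0, one_pos, fun k hk => hk.elim⟩
  have hΓne : Γ.Nonempty := ⟨k₀, hKΓ hk₀⟩
  -- Steps 1–2: Banach–Steinhaus on the rays and Baire over the directions
  have hray' : ∀ η ∈ Γ, ∃ (m : ℕ) (C : ℝ), ∀ t ∈ Ioc (0 : ℝ) 1,
      ∀ F : 𝓓_{ballCompacts (R₀ + 1)}(V, ℂ),
        ‖slicePairing J f μ (ballCompacts (R₀ + 1)) (t • η) F‖ ≤
          C * ContDiffMapSupportedIn.supSeminorm ℂ V ℂ ⊤ (ballCompacts (R₀ + 1)) m F := by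
    intro η hη
    refine exists_seminorm_bound_of_ray_bounded _ η fun F => ?_
    obtain ⟨C, hC⟩ := hray η hη F
    refine ⟨C, fun t ht => ?_⟩
    rw [slicePairing_apply hf.continuousOn (fun x => htube x _ (hΓcone t ht.1 η hη))]
    simp_rw [tubePoint_smul]
    exact hC t ht
  obtain ⟨ô, ρ₀, m, hρ₀, hballΓ, hbound⟩ := exists_ball_seminorm_bound hf.continuousOn hΓo hΓcone
    hΓne htube (ballCompacts (R₀ + 1)) hray'
  have hô : ô ∈ Γ := hballΓ (mem_ball_self hρ₀)
  -- Step 3: the propagation lemma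
  obtain ⟨ε₀, hε₀, hKε⟩ := exists_sub_smul_mem hΓo hK hKΓ ô
  obtain ⟨s₀, hs₀, 𝒴, h𝒴c, h𝒴Γ, hprop⟩ := Literature.Analysis.Complex.norm_le_of_nearCone_of_disc
    (E := E) hΓc hΓcone hô hρ₀ hK hε₀ hKε one_pos
  -- a bound for `f` over the compact pieces `{J(x + a) + iJy : ‖x‖ ≤ R₀, ‖a‖ ≤ 1, y ∈ 𝒴}`
  set T : Set E := (fun p : V × V × V => J (p.1 + p.2.1) + (I : ℂ) • J p.2.2) ''
    (closedBall (0 : V) R₀ ×ˢ closedBall (0 : V) 1 ×ˢ 𝒴) with hT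
  have hTc : IsCompact T :=
    ((isCompact_closedBall 0 R₀).prod ((isCompact_closedBall 0 1).prod h𝒴c)).image (by fun_prop)
  have hTU : T ⊆ U := by
    rintro _ ⟨⟨x, a, y⟩, ⟨-, -, hy⟩, rfl⟩
    exact htube _ _ (h𝒴Γ hy)
  obtain ⟨C𝒴, hC𝒴⟩ := hTc.exists_bound_of_continuousOn (hf.continuousOn.mono hTU)
  set Cμ : ℝ := (‖C𝒴‖ + 1) * μ.real (closedBall (0 : V) R₀) with hCμ
  refine ⟨s₀, m, max (m : ℝ) Cμ, hs₀, fun k hk s hs F => ?_⟩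
  -- the smeared function of `F`
  set g : E → ℂ := fun w => ∫ x, f (J x + w) * F x ∂μ with hg
  set U' : Set E := {w : E | ∀ x ∈ ((ballCompacts R₀ : Compacts V) : Set V), J x + w ∈ U} with hU'
  have hU'o : IsOpen U' := isOpen_setOf_forall_mem_add hU (ballCompacts R₀).isCompact
  have hgd : DifferentiableOn ℂ g U' := differentiableOn_smeared hU hf F
  have htube' : ∀ a : V, ∀ y ∈ Γ, J a + (I : ℂ) • J y ∈ U' := by
    intro a y hy x _
    rw [← add_assoc, ← map_add]
    exact htube _ _ hy
  set Mtot : ℝ := max (m : ℝ) Cμ * ContDiffMapSupportedIn.supSeminorm ℂ V ℂ ⊤ (ballCompacts R₀) m F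
    with hMtot
  have hsn0 : 0 ≤ ContDiffMapSupportedIn.supSeminorm ℂ V ℂ ⊤ (ballCompacts R₀) m F := apply_nonneg _ _
  -- the bound on the directions near `ô`
  have hO : ∀ a y, ‖a - 0‖ ≤ 1 → y ∈ Literature.Analysis.Complex.nearCone ô ρ₀ →
      ‖g (J a + (I : ℂ) • J y)‖ ≤ Mtot := by
    intro a y ha hy
    rw [sub_zero] at ha
    obtain ⟨t, ht, η, hη, rfl⟩ := hy
    have hyΓ : t • η ∈ Γ := hΓcone t ht.1 η (hballΓ hη)
    have h1 : g (J a + (I : ℂ) • J (t • η)) =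
        slicePairing J f μ (ballCompacts (R₀ + 1)) (t • η) (translateTest F a ha) := by
      rw [slicePairing_apply hf.continuousOn (fun x => htube x _ hyΓ)]
      simp only [hg, translateTest_apply]
      exact smeared_tubePoint (μ := μ) F a (t • η)
    rw [h1]
    calc _ ≤ m * ContDiffMapSupportedIn.supSeminorm ℂ V ℂ ⊤ (ballCompacts (R₀ + 1)) m
          (translateTest F a ha) := hbound η hη t ht _
      _ ≤ m * ContDiffMapSupportedIn.supSeminorm ℂ V ℂ ⊤ (ballCompacts R₀) m F :=
          mul_le_mul_of_nonneg_left (supSeminorm_translateTest_le F a ha m) (Nat.cast_nonneg _)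
      _ ≤ Mtot := mul_le_mul_of_nonneg_right (le_max_left _ _) hsn0
  -- the bound on the compact pieces
  have h𝒴 : ∀ a y, ‖a - 0‖ ≤ 1 → y ∈ 𝒴 → ‖g (J a + (I : ℂ) • J y)‖ ≤ Mtot := by
    intro a y ha hy
    rw [sub_zero] at ha
    have hpt : ∀ x ∈ closedBall (0 : V) R₀, ‖f (J x + (J a + (I : ℂ) • J y))‖ ≤ ‖C𝒴‖ + 1 := by
      intro x hx
      have hxT : J x + (J a + (I : ℂ) • J y) ∈ T := by
        refine ⟨(x, a, y), ⟨hx, mem_closedBall_zero_iff.2 ha, hy⟩, ?_⟩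
        simp only [map_add]; abel
      exact (hC𝒴 _ hxT).trans ((le_abs_self _).trans (le_add_of_nonneg_right zero_le_one))
    have hN0 : ∀ x, ‖F x‖ ≤ ContDiffMapSupportedIn.supSeminorm ℂ V ℂ ⊤ (ballCompacts R₀) m F := by
      intro x
      calc ‖F x‖ ≤ N[ℂ]_{ballCompacts R₀, 0} F := norm_apply_le_seminorm ℂ
        _ ≤ ContDiffMapSupportedIn.supSeminorm ℂ V ℂ ⊤ (ballCompacts R₀) m F :=
          Seminorm.le_def.1 (Finset.le_sup (f := ContDiffMapSupportedIn.seminorm ℂ V ℂ ⊤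
            (ballCompacts R₀)) (Finset.mem_Iic.2 (Nat.zero_le m))) F
    calc ‖g (J a + (I : ℂ) • J y)‖
        = ‖∫ x in closedBall (0 : V) R₀, f (J x + (J a + (I : ℂ) • J y)) * F x ∂μ‖ := by
          rw [hg]
          congr 1
          refine (setIntegral_eq_integral_of_forall_compl_eq_zero fun x hx => ?_).symm
          rw [show F x = 0 from F.zero_on_compl hx, mul_zero]
      _ ≤ (‖C𝒴‖ + 1) * ContDiffMapSupportedIn.supSeminorm ℂ V ℂ ⊤ (ballCompacts R₀) m F *
            μ.real (closedBall (0 : V) R₀) := by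
          refine norm_setIntegral_le_of_norm_le_const (isCompact_closedBall 0 R₀).measure_lt_top
            fun x hx => ?_
          rw [norm_mul]
          exact mul_le_mul (hpt x hx) (hN0 x) (norm_nonneg _) (by positivity)
      _ = Cμ * ContDiffMapSupportedIn.supSeminorm ℂ V ℂ ⊤ (ballCompacts R₀) m F := by
          rw [hCμ]; ring
      _ ≤ Mtot := mul_le_mul_of_nonneg_right (le_max_right _ _) hsn0
  have h := hprop J U' hU'o htube' g hgd 0 Mtot hO h𝒴 k hk s hs.1 hs.2
  simpa [hg, hMtot] using h

end Literature.Analysis.Distribution
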